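import Literature.MathematicalPhysics.QuantumFieldTheory.Balaban1983to89.T3LevelShift
import Literature.MathematicalPhysics.QuantumFieldTheory.Balaban1983to89.T3CovarianceRP
import Literature.MathematicalPhysics.QuantumFieldTheory.Balaban1983to89.WilsonLoopDensityFiniteGraph
import Literature.MathematicalPhysics.QuantumFieldTheory.Balaban1983to89.BlockAveragingExpMeanLogContinuous
import HarnessLib

/-!
# `Balaban1983to89.T3ThresholdRemoval` — rung R3, node N9: THRESHOLD REMOVAL BY SUPERRENORMALISABLE SCALING for continuum
# `SU(2)` Yang–Mills on a three-torus, PROVED at Bałaban's continuous exp-mean-log averaging `ℰ = expMeanLogSUc`: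
# `HasContinuumLimit ((F.refine n).scheme ℰ (γL^{-n})) → HasContinuumLimit (F.scheme ℰ γ)`, hence «Y1 with an `m`-uniform
# threshold `γ ≤ γ₁` ⇒ `ContinuumYM3Torus F ℰ γ` for EVERY torus family and EVERY coupling `γ > 0`»

Cell `ym3-torus` (HUMAN RULING D-0037, YM ladder rung R3), seat `ym3-torus-p2` gen 2; node N9 «U_m / threshold removal» of the
cell's typed DAG (HOME/TARGET.md v3 §2 N9 = the leaf `Transfer` of HOME/TARGET-Dag3.lean §7; `T3ContinuumYM3Torus` §8, whose
module text states the mechanism and marks the density step GAP-STATED).  This file CLOSES the density step and the transfer as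
kernel theorems.

HONEST FRAMING.  A CONDITIONAL-TRANSFER theorem: nothing here proves `HasContinuumLimit` for any scheme; what is proved is that
existence for the REFINED family (finer unit, smaller dimensionless coupling, SAME lattices and SAME Wilson weights) implies
existence for the original family, so that a small-coupling threshold UNIFORM IN THE VOLUME EXPONENT (the shape in which the
d = 3 ultraviolet-stability constants are printed: [Balaban1985UV3] (3) p. 256 «a constant O(1) depending on g and ε₀ only»)
costs nothing.  Not d = 4, not infinite volume, not a mass gap, not the expectations step (E3) itself.

THE ARGUMENT (all pieces in the tree).  (i) `T3LevelShift`: the `K`-th lattice of `F.refine n` IS the `(K+n)`-th lattice of `F`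
(`refine_sitesPerDir`, `refine_β` of the node), the Gibbs measures correspond under the product-Haar-preserving reindexing
`fieldShift`, the (0.4) averagings correspond level by level, and the original unit-scale loop variable of label `C` at step
`K + n` is the CONTINUOUS gauge-invariant function `Φ_C = W_C ∘ avg^{n}` of the refined unit field (§§1–3 below).  (ii) Hence both
schemes' expectations are integrals against ONE sequence of probability laws `μ_K` on the refined unit-field space — the
`T4VarianceMatching.UnitFactorisation` interface INHABITED for the d = 3 scheme (§2).  (iii) Lévy's density theorem on the finite
connected unit graph (tree `LevyDensity.dense_su2_of_connected`, [Levy2004] Thm 3.1; `SU(2)`: `traceWordsDense_su2`) puts `Φ`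
uniformly within `ε` of a polynomial `p` in refined loop variables, whose `μ_K`-integrals converge by hypothesis (§4).
(iv) ε/3 (§5).  Continuity of `Φ` is where the CONTINUOUS inhabitant `ExpMeanLog.expMeanLogSUc` of B12's axioms (0.5)–(0.7)
(tree `BlockAveragingExpMeanLogContinuous`, = the printed exp-mean-log on the half-guard; [Balaban1987RG1] p. 253: the averaging
function is «to a large degree arbitrary») is needed: the tree's `expMeanLogSU` jumps at its guard (R-flag THR / D2-CONT of the cell).

## What this file adds (and only this)

§1 Gibbs weights and expectations of two towers with equal finest lattices are ONE (`boltzmann_fieldShift`, `partitionFn_eq_of_PP`,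
   `expect_comp_fieldShift`, `integral_gibbsMeasure_comp_fieldShift`).
§2 `T3Family.unitFactorisation` : `UnitFactorisation (F.scheme ℰ γ) (GaugeField (F.P 0) 0 G)` (`A_K = unitShift K ∘ avg^K`,
   `W_C(u) = loopAt u (C.atLevel 0)`), the unit laws `unitLaw`, `expectAt_eq_integral_unitLaw`.
§3 THE REFINEMENT IDENTITY: `coarseObs F n ℰ Cs` (the original string read on the refined unit field), `avgObs_refine` (pointwise),
   `expectAt_refine : (F.scheme ℰ γ).expectAt (K + n) Cs = ∫ coarseObs … ∂ unitLaw (F.refine n) … K`; continuity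
   (`continuous_coarseObs`, at `expMeanLogSUc`) and gauge invariance (`coarseObs_gaugeAct`).
§4 LÉVY ON THE UNIT THREE-TORUS: walks are graph paths (`isPath_walk`), the unit graph is connected (`exists_isPath_zero`), based
   graph loops are labels (`labelOfLoop`, `loopAt_labelOfLoop`), `SU(2)` trace parts (`tracePart_true_SU2`, `tracePart_false_SU2`),
   every Wilson-loop product of the graph algebra is a constant times a scheme string (`loopTraceProduct_eq_string`).
§5 ε/3 (`exists_tendsto_of_forall_approx`, `tendsto_integral_of_mem_span`) and THE THEOREMS: `exists_tendsto_integral_unitLaw`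
   (E3 ⇒ every continuous gauge-invariant unit-lattice observable has a limit), `hasContinuumLimit_of_refine`,
   `continuumYM3Torus_of_refine`, `continuumYM3Torus_of_refine_threshold` (one family: a threshold uniform along its refinements
   is no threshold), `continuumYM3Torus_of_uniform_threshold` (all families; `SU(2)`, `ℰ = expMeanLogSUc`).

WHAT IS NOT PROVED.  Any instance of `HasContinuumLimit`; anything for `SU(N)`, `N ≥ 3` (there the real parts `Re tr` of loop
holonomies do not separate `U` from `Ū`, so the node's observable class is not dense and Lévy's theorem needs `Im tr` too);
anything at `ℰ = expMeanLogSU` (discontinuous guard) or `ℰ = trivial` (R-flag ETRIV: thin loops).  The fifth (NG) conjunct is not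
transferred.  Sources located: [Balaban1985UV3] (1)–(3) p. 256 (`g₀² = g²ε`, `K`, `ε₀`: the scaling), [Balaban1987RG1] (0.2)/(0.4)
pp. 252–253, [Levy2004] Thm 3.1, [JaffeWittenClay2006] §6.5 p. 11 (the existence clause transferred).
-/

noncomputable section

open MeasureTheory Filter Topology
open Literature.MathematicalPhysics.QuantumFieldTheory.Balaban1983to89.T3ContinuumYM3Torus
open Literature.MathematicalPhysics.QuantumFieldTheory.Balaban1983to89.T3LevelShift
open Literature.MathematicalPhysics.QuantumFieldTheory.Balaban1983to89.Missing
open Literature.MathematicalPhysics.QuantumFieldTheory.Balaban1983to89.T4Continuum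

namespace Literature.MathematicalPhysics.QuantumFieldTheory.Balaban1983to89.T3ThresholdRemoval

/-! ## §0 Local helpers: products over a list of functions -/

/-- Products of a list of measurable real functions are measurable (local helper). [folklore] -/
private theorem measurable_list_prod {X : Type*} [MeasurableSpace X] {ι : Type*} (f : ι → X → ℝ)
    (hf : ∀ i, Measurable (f i)) : ∀ l : List ι, Measurable fun x => (l.map fun i => f i x).prod
  | [] => by simp
  | i :: l => by
    show Measurable fun x => f i x * (l.map fun i => f i x).prod
    exact (hf i).mul (measurable_list_prod f hf l)

/-- Products of a list of continuous real functions are continuous (local helper). [folklore] -/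
private theorem continuous_list_prod {X : Type*} [TopologicalSpace X] {ι : Type*} (f : ι → X → ℝ)
    (hf : ∀ i, Continuous (f i)) : ∀ l : List ι, Continuous fun x => (l.map fun i => f i x).prod
  | [] => by simpa using continuous_const
  | i :: l => by
    show Continuous fun x => f i x * (l.map fun i => f i x).prod
    exact (hf i).mul (continuous_list_prod f hf l)

/-- Products of a list of functions bounded by `1` are bounded by `1` (local helper). [folklore] -/
private theorem abs_list_prod_le_one {X : Type*} {ι : Type*} (f : ι → X → ℝ) (hf : ∀ i x, |f i x| ≤ 1) (x : X) :
    ∀ l : List ι, |(l.map fun i => f i x).prod| ≤ 1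
  | [] => by simp
  | i :: l => by
    rw [List.map_cons, List.prod_cons, abs_mul]
    exact mul_le_one₀ (hf i x) (abs_nonneg _) (abs_list_prod_le_one f hf x l)

/-! ## §1 Two towers with equal finest lattices carry ONE Gibbs measure -/

section Gibbs

variable {F : T3Family} {m K m' K' : ℕ} {G : Type*} [GaugeGroup G]

/-- The Boltzmann weights `exp(−βA(U))` of two towers with equal finest lattices are one function ([Balaban1985UV3] (1) p. 256:
`ρ₀ = exp[−g₀⁻²A(U) − E]`, `A` the Wilson action of the finest lattice). [cite: Balaban1985UV3, (1)-(3) p.256] -/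
theorem boltzmann_fieldShift (h : (F.PP m K).sitesPerDir 0 = (F.PP m' K').sitesPerDir 0) (β : ℝ)
    (V : GaugeField (F.PP m' K') 0 G) :
    Missing.boltzmann (F.PP m K) β (fieldShift h V) = Missing.boltzmann (F.PP m' K') β V := by
  rw [Missing.boltzmann, Missing.boltzmann, wilsonAction4_fieldShift]

variable [MeasurableSpace G] [HaarData G]

/-- The partition functions agree. [cite: Balaban1985UV3, (1)-(3) p.256] -/
theorem partitionFn_eq_of_PP (h : (F.PP m K).sitesPerDir 0 = (F.PP m' K').sitesPerDir 0) (β : ℝ) :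
    Missing.partitionFn (G := G) (F.PP m K) β = Missing.partitionFn (G := G) (F.PP m' K') β := by
  rw [Missing.partitionFn, Missing.partitionFn, ← integral_comp_fieldShift h]
  simp_rw [boltzmann_fieldShift h β]

/-- **EXPECTATIONS CORRESPOND**: `⟨f⟩_{(m,K),β} = ⟨f ∘ fieldShift h⟩_{(m′,K′),β}` (change of variables under the product Haar
measure, equal Boltzmann weights and partition functions). [cite: Balaban1985UV3, (1)-(3) p.256] -/
theorem expect_comp_fieldShift (h : (F.PP m K).sitesPerDir 0 = (F.PP m' K').sitesPerDir 0) (β : ℝ)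
    (f : GaugeField (F.PP m K) 0 G → ℝ) :
    Missing.expect (F.PP m K) β f = Missing.expect (F.PP m' K') β (fun V => f (fieldShift h V)) := by
  rw [Missing.expect, Missing.expect, ← partitionFn_eq_of_PP h, ← integral_comp_fieldShift h]
  simp_rw [boltzmann_fieldShift h β]

variable [RegularGaugeGroup G]

/-- The same in the language of the tree's Gibbs MEASURES (`T4GenFunBounds.gibbsMeasure`, `β ≥ 0`):
`∫ f ∘ fieldShift h d(Gibbs′) = ∫ f d(Gibbs)`. [cite: Balaban1985UV3, (1)-(3) p.256] -/
theorem integral_gibbsMeasure_comp_fieldShift (h : (F.PP m K).sitesPerDir 0 = (F.PP m' K').sitesPerDir 0) {β : ℝ}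
    (hβ : 0 ≤ β) (f : GaugeField (F.PP m K) 0 G → ℝ) :
    ∫ V, f (fieldShift h V) ∂T4GenFunBounds.gibbsMeasure (F.PP m' K') β =
      ∫ U, f U ∂T4GenFunBounds.gibbsMeasure (F.PP m K) β := by
  rw [T4GenFunBounds.integral_gibbsMeasure_eq_expect _ hβ, T4GenFunBounds.integral_gibbsMeasure_eq_expect _ hβ,
    expect_comp_fieldShift h]

end Gibbs

/-! ## §2 The d = 3 scheme's observables factor through the unit field: `UnitFactorisation` inhabited; the unit laws -/

section UnitLaw

variable (F : T3Family) {G : Type*} [GaugeGroup G] [MeasurableSpace G] [HaarData G] [RegularGaugeGroup G]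
  (ℰ : LoopAverage G) (hE : ℰ.MeasurableE) (γ : ℝ)

/-- **THE UNIT FACTORISATION OF THE d = 3 WILSON SCHEME** (the interface `T4VarianceMatching.UnitFactorisation` INHABITED, for a
measurable small-loop average): `X` = configurations of the unit torus `T₁` read on `USite`, `A_K = unitShift K ∘ avg^K` ([Balaban1987RG1]
(0.4) iterated to the unit lattice), `W_C(u) = loopAt u (C.atLevel 0)` — the defining feature «unit-scale averaged expectations». [cite: Balaban1987RG1, (0.2)/(0.4) p.252] -/
def _root_.Literature.MathematicalPhysics.QuantumFieldTheory.Balaban1983to89.T3ContinuumYM3Torus.T3Family.unitFactorisation :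
    T4VarianceMatching.UnitFactorisation (F.scheme ℰ γ) (GaugeField (F.P 0) 0 G) where
  A K U := unitShift F K (Averaging.iter (fun j => BlockAveraging.blockAvg (P := F.P K) (j := j) ℰ) K U)
  measurable_A K := (measurable_unitShift F K).comp (measurable_iter _ (F.avgMeasurable_of_measurableE ℰ hE K) K)
  W C u := loopAt u (C.1.atLevel 0)
  measurable_W _ := measurable_loopAt _
  abs_W_le_one _ _ := abs_loopAt_le_one _ _
  fac K C U := F.avgObs_eq_loopAt_unitShift ℰ K C U

/-- THE UNIT LAW of step `K`: the push-forward of the `K`-th Gibbs measure to the unit-field space (Bałaban's `ρ_K dV` after `K`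
complete steps, [Balaban1985UV3] (2) p. 256 `ρ_{k+1} = Tρ_k`, as a LAW on unit-lattice configurations). [cite: Balaban1985UV3, (1)-(3) p.256] -/
def _root_.Literature.MathematicalPhysics.QuantumFieldTheory.Balaban1983to89.T3ContinuumYM3Torus.T3Family.unitLaw (K : ℕ) :
    Measure (GaugeField (F.P 0) 0 G) :=
  (F.unitFactorisation ℰ hE γ).effLaw K

variable {F ℰ γ}

/-- The unit laws are probability measures (`γ ≥ 0`). [cite: Balaban1985UV3, (1)-(3) p.256] -/
theorem isProbabilityMeasure_unitLaw (hγ : 0 ≤ γ) (K : ℕ) : IsProbabilityMeasure (F.unitLaw ℰ hE γ K) :=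
  (F.unitFactorisation ℰ hE γ).isProbabilityMeasure_effLaw (F.scheme_β_nonneg ℰ hγ) K

/-- Integration against the unit law = integration of the pulled-back function against the Gibbs measure. [cite: Balaban1985UV3, (1)-(3) p.256] -/
theorem integral_unitLaw (K : ℕ) {f : GaugeField (F.P 0) 0 G → ℝ} (hf : Measurable f) :
    ∫ u, f u ∂F.unitLaw ℰ hE γ K =
      ∫ U, f (unitShift F K (Averaging.iter (fun j => BlockAveraging.blockAvg (P := F.P K) (j := j) ℰ) K U))
        ∂T4GenFunBounds.gibbsMeasure (F.P K) ((F.scheme ℰ γ).β K) := by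
  rw [T3Family.unitLaw, T4VarianceMatching.UnitFactorisation.effLaw,
    integral_map ((F.unitFactorisation ℰ hE γ).measurable_A K).aemeasurable hf.aestronglyMeasurable]
  rfl

/-- **JOINT EXPECTATIONS AS INTEGRALS OVER THE UNIT LAW**: `⟨∏_{C∈Cs} W̄_C⟩_K = ∫ ∏_C loopAt u (C.atLevel 0) d(unitLaw K)`. [cite: Balaban1987RG1, (0.2)/(0.4) p.252] -/
theorem expectAt_eq_integral_unitLaw (hγ : 0 ≤ γ) (K : ℕ) (Cs : List (ULoop3 F)) :
    (F.scheme ℰ γ).expectAt K Cs = ∫ u, (Cs.map fun C => loopAt u (C.1.atLevel 0)).prod ∂F.unitLaw ℰ hE γ K := by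
  rw [integral_unitLaw hE K (measurable_list_prod (fun (C : ULoop3 F) (u : GaugeField (F.P 0) 0 G) =>
      loopAt u (C.1.atLevel 0)) (fun C => measurable_loopAt _) Cs),
    T4GenFunBounds.expectAt_eq_integral_gibbs _ (F.scheme_β_nonneg ℰ hγ) K Cs]
  refine integral_congr_ae (Eventually.of_forall fun U => ?_)
  show (Cs.map fun C => F.avgObs ℰ K C U).prod = _
  simp_rw [F.avgObs_eq_loopAt_unitShift ℰ K]

end UnitLaw

/-! ## §3 The refinement identity: the original string at step `K + n` is a function of the refined unit field -/

section Refine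

variable (F : T3Family) (n : ℕ) {G : Type*} [GaugeGroup G] (ℰ : LoopAverage G)

/-- Equal moduli: level `0` of `F.P n` and level `0` of `(F.refine n).P 0` (both `2·L^{m+n}` sites per direction). [cite: Balaban1985UV3, (1)-(3) p.256] -/
theorem sitesPerDir_refine_unit : (F.PP F.m n).sitesPerDir 0 = (F.PP (F.m + n) 0).sitesPerDir 0 :=
  F.sitesPerDir_eq (by omega)

/-- Equal moduli: the finest lattice of `F.P (K + n)` and of `(F.refine n).P K`. [cite: Balaban1985UV3, (1)-(3) p.256] -/
theorem sitesPerDir_refine_zero (K : ℕ) : (F.PP F.m (K + n)).sitesPerDir 0 = (F.PP (F.m + n) K).sitesPerDir 0 :=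
  F.sitesPerDir_eq (by omega)

/-- Equal moduli: the refined family's unit lattice at level `0` of its `0`-th and at level `K` of its `K`-th approximation. [cite: Balaban1985UV3, (1)-(3) p.256] -/
theorem sitesPerDir_refine_top (K : ℕ) : (F.PP (F.m + n) 0).sitesPerDir 0 = (F.PP (F.m + n) K).sitesPerDir K :=
  F.sitesPerDir_eq (by omega)

omit [GaugeGroup G] in
/-- The refined family's unit map is the identification along `sitesPerDir_refine_top` (definitional; stated to keep every
identification indexed by ONE family `F`). [cite: Balaban1987RG1, (0.1) p.251] -/
theorem unitShift_refine (K : ℕ) (X : GaugeField (F.PP (F.m + n) K) K G) :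
    unitShift (F.refine n) K X = fieldShift (sitesPerDir_refine_top F n K) X :=
  rfl

/-- **THE ORIGINAL STRING READ ON THE REFINED UNIT FIELD**: `Φ_{Cs}(u) = ∏_{C∈Cs} W̄_C(avg^{n} u)`, `u` a configuration of the refined
family's unit torus (`2L^{m+n}` sites per direction = level `0` of `F.P n`), averaged `n` more times by (0.4) to `T₁` and read along the
label `C` ([Balaban1987RG1] (0.11): `Ū^{k} = M^{k}(U)` composes). [cite: Balaban1987RG1, (0.11) p.253] -/
def coarseObs (Cs : List (ULoop3 F)) (u : GaugeField ((F.refine n).P 0) 0 G) : ℝ :=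
  (Cs.map fun C => F.avgObs ℰ n C (fieldShift (sitesPerDir_refine_unit F n) u)).prod

/-- **THE POINTWISE REFINEMENT IDENTITY**: the averaged loop variable of label `C` at step `K + n` of `F`, evaluated on a fine
configuration read from the refined family's `K`-th finest lattice, is `W̄_C(avg^{n} ·)` of the refined family's unit field
`unitShift K (avg^K V)` — `avg^{K+n} = avg^{n} ∘ avg^{K}` across the two towers. [cite: Balaban1987RG1, (0.11) p.253] -/
theorem avgObs_refine (K : ℕ) (C : ULoop3 F) (V : GaugeField (F.PP (F.m + n) K) 0 G) :
    F.avgObs ℰ (K + n) C (fieldShift (sitesPerDir_refine_zero F n K) V) =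
      F.avgObs ℰ n C (fieldShift (sitesPerDir_refine_unit F n)
        (unitShift (F.refine n) K (Averaging.iter (fun j => BlockAveraging.blockAvg (P := F.PP (F.m + n) K) (j := j) ℰ) K V))) := by
  -- both sides in the language of the two-parameter family `F.PP`
  show loopAt (Averaging.iter (fun j => BlockAveraging.blockAvg (P := F.PP F.m (K + n)) (j := j) ℰ) (K + n)
      (fieldShift (sitesPerDir_refine_zero F n K) V)) (C.1.atLevel (K + n)) =
    loopAt (Averaging.iter (fun j => BlockAveraging.blockAvg (P := F.PP F.m n) (j := j) ℰ) n
      (fieldShift (sitesPerDir_refine_unit F n) (fieldShift (sitesPerDir_refine_top F n K)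
        (Averaging.iter (fun j => BlockAveraging.blockAvg (P := F.PP (F.m + n) K) (j := j) ℰ) K V)))) (C.1.atLevel n)
  rw [T4AvgSensitivity.iter_add, iter_fieldShift ℰ (show F.m + (K + n) = F.m + n + K by omega) K V,
    fieldShift_fieldShift,
    ← loopAt_fieldShift_atLevel (F.sitesPerDir_eq (m := F.m) (K := n) (j := n) (m' := F.m) (K' := K + n)
      (j' := K + n) (by omega)),
    iterFrom_fieldShift ℰ (show F.m + (K + n) = F.m + n + K by omega) n, fieldShift_fieldShift]

/-- `coarseObs` is GAUGE INVARIANT under the gauge transformations of the refined unit torus (covariance of (0.4) up the levels,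
[Balaban1985Averaging] (11)–(13), closed representative walks). [cite: Balaban1985Averaging, (11) p.19] -/
theorem coarseObs_gaugeAct (Cs : List (ULoop3 F)) (u : GaugeTransf ((F.refine n).P 0) 0 G)
    (U : GaugeField ((F.refine n).P 0) 0 G) : coarseObs F n ℰ Cs (GaugeField.gaugeAct u U) = coarseObs F n ℰ Cs U := by
  unfold coarseObs
  congr 1
  refine List.map_congr_left fun C _ => ?_
  show F.avgObs ℰ n C (fieldShift (sitesPerDir_refine_unit F n) (GaugeField.gaugeAct (P := F.PP (F.m + n) 0) u U)) = _
  rw [fieldShift_gaugeAct]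
  exact F.gaugeInvariant_avgObs ℰ n C _ _

/-- `|coarseObs| ≤ 1`. [cite: Balaban1987RG1, (0.2)/(0.4) p.252] -/
theorem abs_coarseObs_le_one [MeasurableSpace G] [RegularGaugeGroup G] (Cs : List (ULoop3 F))
    (u : GaugeField ((F.refine n).P 0) 0 G) : |coarseObs F n ℰ Cs u| ≤ 1 :=
  abs_list_prod_le_one (fun (C : ULoop3 F) (u : GaugeField ((F.refine n).P 0) 0 G) =>
    F.avgObs ℰ n C (fieldShift (sitesPerDir_refine_unit F n) u)) (fun C _ => F.abs_avgObs_le_one ℰ n C _) u Cs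

variable [MeasurableSpace G] [RegularGaugeGroup G]

/-- `coarseObs` is measurable (measurable small-loop average). [cite: Balaban1987RG1, (0.4) p.253] -/
theorem measurable_coarseObs (hE : ℰ.MeasurableE) (Cs : List (ULoop3 F)) : Measurable (coarseObs F n ℰ Cs) :=
  measurable_list_prod (fun (C : ULoop3 F) (u : GaugeField ((F.refine n).P 0) 0 G) =>
    F.avgObs ℰ n C (fieldShift (sitesPerDir_refine_unit F n) u))
    (fun C => (F.measurable_avgObs (F.avgMeasurable_of_measurableE ℰ hE) n C).comp (measurable_fieldShift _)) Cs

/-- **THE REFINEMENT IDENTITY FOR EXPECTATIONS**: the original scheme's joint expectation at step `K + n` is the integral of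
`coarseObs` against the REFINED scheme's unit law at step `K` (same lattice `2L^{m+K+n}`, same Wilson weight `β = (γL^{-(K+n)})⁻¹`
by the node's `refine_β`, (0.4) composed across the towers). [cite: Balaban1985UV3, (1)-(3) p.256] -/
theorem expectAt_refine [HaarData G] (hE : ℰ.MeasurableE) {γ : ℝ} (hγ : 0 ≤ γ) (K : ℕ) (Cs : List (ULoop3 F)) :
    (F.scheme ℰ γ).expectAt (K + n) Cs =
      ∫ u, coarseObs F n ℰ Cs u ∂(F.refine n).unitLaw ℰ hE (γ * ((F.L : ℝ)⁻¹) ^ n) K := by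
  have hβ : 0 ≤ (F.scheme ℰ γ).β (K + n) := F.scheme_β_nonneg ℰ hγ (K + n)
  calc (F.scheme ℰ γ).expectAt (K + n) Cs
      = ∫ U, (Cs.map fun C => F.avgObs ℰ (K + n) C U).prod
          ∂T4GenFunBounds.gibbsMeasure (F.PP F.m (K + n)) ((F.scheme ℰ γ).β (K + n)) :=
        T4GenFunBounds.expectAt_eq_integral_gibbs _ (F.scheme_β_nonneg ℰ hγ) (K + n) Cs
    _ = ∫ V, (Cs.map fun C => F.avgObs ℰ (K + n) C (fieldShift (sitesPerDir_refine_zero F n K) V)).prod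
          ∂T4GenFunBounds.gibbsMeasure (F.PP (F.m + n) K) ((F.scheme ℰ γ).β (K + n)) :=
        (integral_gibbsMeasure_comp_fieldShift (sitesPerDir_refine_zero F n K) hβ _).symm
    _ = ∫ V, coarseObs F n ℰ Cs (unitShift (F.refine n) K
          (Averaging.iter (fun j => BlockAveraging.blockAvg (P := F.PP (F.m + n) K) (j := j) ℰ) K V))
          ∂T4GenFunBounds.gibbsMeasure (F.PP (F.m + n) K) ((F.scheme ℰ γ).β (K + n)) := by
        simp only [coarseObs, avgObs_refine]
    _ = ∫ u, coarseObs F n ℰ Cs u ∂(F.refine n).unitLaw ℰ hE (γ * ((F.L : ℝ)⁻¹) ^ n) K := by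
        rw [integral_unitLaw hE K (measurable_coarseObs F n ℰ hE Cs), T3Family.refine_β]
        rfl

end Refine

section Continuity

variable (F : T3Family) (n : ℕ) {N : Type} [Fintype N] [DecidableEq N] [Nonempty N]

/-- `fieldShift` is continuous (a reindexing of coordinates; local helper). [folklore] -/
private theorem continuous_fieldShift {m K j m' K' j' : ℕ} {G : Type*} [TopologicalSpace G]
    (h : (F.PP m K).sitesPerDir j = (F.PP m' K').sitesPerDir j') :
    Continuous (fieldShift h : GaugeField (F.PP m' K') j' G → GaugeField (F.PP m K) j G) :=
  continuous_pi fun _ => continuous_apply _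

/-- **AT THE CONTINUOUS AVERAGING `expMeanLogSUc` THE ORIGINAL STRING IS A CONTINUOUS FUNCTION OF THE REFINED UNIT FIELD** (tree
`BlockAveraging.continuous_iter_blockAvg_expMeanLogSUc`, `continuous_holAt`; continuity of `Re tr/N` on `SU(N)`). [cite: Balaban1987RG1, (0.4) p.253] -/
theorem continuous_coarseObs (Cs : List (ULoop3 F)) :
    Continuous (coarseObs F n (ExpMeanLog.expMeanLogSUc (n := N)) Cs) := by
  have hre : Continuous (reTr : Matrix.specialUnitaryGroup N ℂ → ℝ) :=
    UnitaryModel.continuous_nReTr.comp (Literature.MathematicalPhysics.QuantumLattice.continuous_fundamentalRep N)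
  refine continuous_list_prod (fun (C : ULoop3 F) (u : GaugeField ((F.refine n).P 0) 0 (Matrix.specialUnitaryGroup N ℂ)) =>
    F.avgObs (ExpMeanLog.expMeanLogSUc (n := N)) n C (fieldShift (sitesPerDir_refine_unit F n) u)) (fun C => ?_) Cs
  exact (hre.comp (BlockAveraging.continuous_holAt (C.1.atLevel n))).comp
    ((BlockAveraging.continuous_iter_blockAvg_expMeanLogSUc n).comp (continuous_fieldShift F (sitesPerDir_refine_unit F n)))

end Continuity

/-! ## §4 Lévy's density theorem on the unit three-torus: graph paths are walks, based graph loops are labels -/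

section Graph

variable {F : T3Family}

/-- A walk step of `T4Continuum` as a signed edge of the bond graph (edges = positive bonds, `src`/`tgt` their endpoints). [cite: Levy2004, §2] -/
def toPair {P : Params} {j : ℕ} (s : LStep P j) : PBond P j × Bool := (s.bond, s.fwd)

/-- The word of a signed-edge list: directions and orientations. [cite: Levy2004, §2] -/
def wordOfPairs {P : Params} {j : ℕ} (l : List (PBond P j × Bool)) : List (Letter P.d) := l.map fun a => (a.1.dir, a.2)

/-- Holonomies of `T4Continuum` are the word values `wordVal` of the graph formalisation (module XX / `LevyDensity`):
`holAt U γ = wordVal (γ.map toPair) U`. [cite: Levy2004, §2] -/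
theorem holAt_eq_wordVal {P : Params} {j : ℕ} {G : Type*} [GaugeGroup G] (U : GaugeField P j G) (γ : List (LStep P j)) :
    holAt U γ = wordVal (γ.map toPair) U := by
  induction γ with
  | nil => simp [holAt]
  | cons s γ ih =>
    rw [holAt_cons, ih, List.map_cons, wordVal_cons]
    rfl

/-- THE WALK OF A WORD IS A GRAPH PATH from its base to its endpoint (the step `−e_μ` from `x` is the bond `⟨x − e_μ, μ⟩` backward,
whose start `(x − e_μ) + e_μ = x`). [cite: Levy2004, §2] -/
theorem isPath_walk {P : Params} {j : ℕ} :
    ∀ (x : Site P j) (w : List (Letter P.d)),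
      LevyDensity.IsPath PBond.src PBond.tgt x ((walk x w).map toPair) (walkEnd x w)
  | _, [] => rfl
  | x, (μ, true) :: w => by
    simp only [walk, walkEnd, List.map_cons, LevyDensity.isPath_cons]
    exact ⟨rfl, isPath_walk (x.shift μ) w⟩
  | x, (μ, false) :: w => by
    simp only [walk, walkEnd, List.map_cons, LevyDensity.isPath_cons]
    exact ⟨Site.shift_unshift x μ, isPath_walk (x.unshift μ) w⟩

/-- **THE UNIT THREE-TORUS GRAPH IS CONNECTED**: every site is reached from `0` by the walk of a staircase word (`BlockAveraging.stairWord`,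
net displacement = the site's representatives). [cite: Levy2004, Thm 3.1] -/
theorem exists_isPath_zero {P : Params} {j : ℕ} (x : Site P j) :
    ∃ l, LevyDensity.IsPath PBond.src PBond.tgt (0 : Site P j) l x := by
  refine ⟨(walk (0 : Site P j) (stairWord 1 fun ν => ((x ν).val : ℤ))).map toPair, ?_⟩
  have hend : walkEnd (0 : Site P j) (stairWord 1 fun ν => ((x ν).val : ℤ)) = x := by
    funext ν
    rw [walkEnd_apply, netDisp_stairWord, Int.cast_natCast, ZMod.natCast_zmod_val]
    exact zero_add _
  simpa only [hend] using isPath_walk (0 : Site P j) (stairWord 1 fun ν => ((x ν).val : ℤ))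

/-- A graph path starting at `x` IS the walk of its word from `x`, and ends where the walk ends. [cite: Levy2004, §2] -/
theorem walk_wordOfPairs {P : Params} {j : ℕ} :
    ∀ {x y : Site P j} {l : List (PBond P j × Bool)}, LevyDensity.IsPath PBond.src PBond.tgt x l y →
      (walk x (wordOfPairs l)).map toPair = l ∧ walkEnd x (wordOfPairs l) = y
  | x, y, [], h => ⟨rfl, h⟩
  | x, y, (b, true) :: l, h => by
    obtain ⟨hb, hl⟩ := h
    obtain ⟨h1, h2⟩ := walk_wordOfPairs hl
    have hb' : b.src = x := hb
    subst hb'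
    exact ⟨congrArg (List.cons (b, true)) h1, h2⟩
  | x, y, (b, false) :: l, h => by
    obtain ⟨hb, hl⟩ := h
    obtain ⟨h1, h2⟩ := walk_wordOfPairs hl
    have hb' : b.src.shift b.dir = x := hb
    subst hb'
    simp only [wordOfPairs, List.map_cons, walk, walkEnd, Site.unshift_shift]
    exact ⟨congrArg (List.cons (b, false)) h1, h2⟩

/-- A CLOSED graph path spells a CLOSED word (`UWord3.IsLoop`: zero net displacement modulo the period). [cite: Levy2004, §2] -/
theorem isLoop_wordOfPairs {x : F.USite} {l : List (PBond (F.P 0) 0 × Bool)}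
    (h : LevyDensity.IsPath PBond.src PBond.tgt x l x) : UWord3.IsLoop (F := F) ⟨x, wordOfPairs l⟩ := by
  intro ν
  have hend := congrFun (walk_wordOfPairs h).2 ν
  rw [walkEnd_apply] at hend
  simpa using hend

/-- **A BASED GRAPH LOOP OF THE UNIT TORUS IS A LABEL OF THE SCHEME**: the closed word it spells, based at its base point. [cite: Levy2004, Thm 3.1] -/
def labelOfLoop {x : F.USite} (ℓ : LevyDensity.Loop (PBond.src (P := F.P 0) (j := 0)) PBond.tgt x) : ULoop3 F :=
  ⟨⟨x, wordOfPairs ℓ.1⟩, isLoop_wordOfPairs ℓ.2⟩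

/-- `toLevel 0` is the identity on `USite` (coherence of `T3Family.siteEquiv` at `K = 0`). [cite: Balaban1987RG1, (0.1) p.251] -/
theorem toLevel_zero (x : F.USite) : F.toLevel 0 x = x := by
  funext ν
  apply ZMod.val_injective
  exact val_toLevel 0 x ν

/-- The unit observable of the label of a based graph loop is the normalised trace of the loop's holonomy:
`W_{labelOfLoop ℓ}(u) = Re tr hol_u(ℓ)/N`. [cite: Levy2004, Thm 3.1] -/
theorem loopAt_labelOfLoop {G : Type*} [GaugeGroup G] {x : F.USite}
    (ℓ : LevyDensity.Loop (PBond.src (P := F.P 0) (j := 0)) PBond.tgt x) (u : GaugeField (F.P 0) 0 G) :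
    loopAt u ((labelOfLoop ℓ).1.atLevel 0) = reTr (wordVal ℓ.1 u) := by
  show reTr (holAt u (walk (F.toLevel 0 x) (wordOfPairs ℓ.1))) = _
  rw [toLevel_zero, holAt_eq_wordVal, (walk_wordOfPairs ℓ.2).1]

open Literature.MathematicalPhysics.QuantumLattice in
/-- `SU(2)`: the real part of the fundamental character is twice the normalised trace `reTr = Re tr/2` of the tree's model. [folklore] -/
private theorem tracePart_true_SU2 (g : Matrix.specialUnitaryGroup (Fin 2) ℂ) :
    tracePart (fundamentalRep (Fin 2)) true g = 2 * reTr g := by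
  show ((fundamentalRep (Fin 2) g).trace).re = 2 * UnitaryModel.nReTr (fundamentalRep (Fin 2) g)
  simp only [UnitaryModel.nReTr, Fintype.card_fin]
  push_cast
  ring

open Literature.MathematicalPhysics.QuantumLattice in
/-- `SU(2)`: the trace is real (`gᴴ = adj g` for `det g = 1`), so the imaginary part of the fundamental character vanishes. [folklore] -/
private theorem tracePart_false_SU2 (g : Matrix.specialUnitaryGroup (Fin 2) ℂ) :
    tracePart (fundamentalRep (Fin 2)) false g = 0 := by
  show ((g : Matrix (Fin 2) (Fin 2) ℂ).trace).im = 0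
  obtain ⟨hU, hdet⟩ := Matrix.mem_specialUnitaryGroup_iff.mp g.2
  set A : Matrix (Fin 2) (Fin 2) ℂ := (g : Matrix (Fin 2) (Fin 2) ℂ)
  have h1 : star A * A = 1 := Matrix.mem_unitaryGroup_iff'.mp hU
  have h2 : A.adjugate * A = 1 := by rw [Matrix.adjugate_mul, hdet, one_smul]
  have h3 : star A = A.adjugate := by rw [← Matrix.inv_eq_left_inv h1, Matrix.inv_eq_left_inv h2]
  have h4 : star (A 0 0) = A 1 1 := by
    have := congrFun (congrFun h3 0) 0
    rw [Matrix.adjugate_fin_two] at this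
    simpa [Matrix.star_apply] using this
  rw [Matrix.trace_fin_two, ← h4, Complex.star_def, Complex.add_im, Complex.conj_im]
  ring

open Literature.MathematicalPhysics.QuantumLattice in
/-- **EVERY WILSON-LOOP PRODUCT OF THE UNIT GRAPH ALGEBRA IS A CONSTANT TIMES A SCHEME STRING** (`SU(2)`): a finite product of
`Re/Im tr hol(ℓ_k)` over based loops equals `c · ∏_k W_{C_k}` for the labels `C_k = labelOfLoop ℓ_k` (`c = 2^{#Re}`, or `0` if an
`Im` factor occurs). [cite: Levy2004, Thm 3.1] -/
theorem loopTraceProduct_eq_string {x : F.USite} :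
    ∀ l : List (LevyDensity.Loop (PBond.src (P := F.P 0) (j := 0)) PBond.tgt x × Bool),
      ∃ (c : ℝ) (Cs : List (ULoop3 F)),
        LevyDensity.loopTraceProduct PBond.src PBond.tgt (fundamentalRep (Fin 2)) x l =
          fun u => c * (Cs.map fun C => loopAt u (C.1.atLevel 0)).prod
  | [] => ⟨1, [], by funext u; simp [LevyDensity.loopTraceProduct]⟩
  | (ℓ, true) :: l => by
    obtain ⟨c, Cs, h⟩ := loopTraceProduct_eq_string l
    refine ⟨2 * c, labelOfLoop ℓ :: Cs, funext fun u => ?_⟩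
    have hu := congrFun h u
    simp only [LevyDensity.loopTraceProduct, List.map_cons, List.prod_cons] at hu ⊢
    rw [hu, tracePart_true_SU2, loopAt_labelOfLoop]
    ring
  | (ℓ, false) :: l => by
    obtain ⟨c, Cs, h⟩ := loopTraceProduct_eq_string l
    refine ⟨0, Cs, funext fun u => ?_⟩
    simp only [LevyDensity.loopTraceProduct, List.map_cons, List.prod_cons, tracePart_false_SU2, zero_mul]

end Graph

/-! ## §5 ε/3 and the theorems -/

section Apex

/-- A real sequence uniformly approximable, to every accuracy, by convergent sequences converges (Cauchy, `ℝ` complete). [folklore] -/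
private theorem exists_tendsto_of_forall_approx {a : ℕ → ℝ}
    (h : ∀ ε > 0, ∃ b : ℕ → ℝ, (∃ l, Tendsto b atTop (𝓝 l)) ∧ ∀ K, |a K - b K| ≤ ε) :
    ∃ l, Tendsto a atTop (𝓝 l) := by
  apply cauchySeq_tendsto_of_complete
  rw [Metric.cauchySeq_iff]
  intro ε hε
  obtain ⟨b, ⟨l, hb⟩, hab⟩ := h (ε / 3) (by positivity)
  have hbc := Metric.cauchySeq_iff.mp hb.cauchySeq (ε / 3) (by positivity)
  obtain ⟨N, hN⟩ := hbc
  refine ⟨N, fun p hp q hq => ?_⟩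
  have h1 := hab p
  have h2 := hab q
  have h3 := hN p hp q hq
  rw [Real.dist_eq] at h3 ⊢
  calc |a p - a q| = |(a p - b p) + (b p - b q) + (b q - a q)| := by ring_nf
    _ ≤ |a p - b p| + |b p - b q| + |b q - a q| := abs_add_three _ _ _
    _ < ε := by rw [abs_sub_comm (b q) (a q)]; linarith

/-- Convergence of integrals against a sequence of probability laws passes to the real LINEAR SPAN of a class of bounded measurable
functions (with the bound and the measurability). [folklore] -/
private theorem tendsto_integral_of_mem_span {X : Type*} [MeasurableSpace X] (μ : ℕ → Measure X)
    [∀ K, IsProbabilityMeasure (μ K)] {S : Set (X → ℝ)}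
    (hS : ∀ q ∈ S, (∃ B, ∀ u, |q u| ≤ B) ∧ Measurable q ∧ ∃ l, Tendsto (fun K => ∫ u, q u ∂μ K) atTop (𝓝 l))
    {p : X → ℝ} (hp : p ∈ Submodule.span ℝ S) :
    (∃ B, ∀ u, |p u| ≤ B) ∧ Measurable p ∧ ∃ l, Tendsto (fun K => ∫ u, p u ∂μ K) atTop (𝓝 l) := by
  induction hp using Submodule.span_induction with
  | mem q hq => exact hS q hq
  | zero => exact ⟨⟨0, fun u => by simp⟩, measurable_const, ⟨0, by simp⟩⟩
  | add p q _ _ hp hq =>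
    obtain ⟨⟨Bp, hBp⟩, hpm, lp, hlp⟩ := hp
    obtain ⟨⟨Bq, hBq⟩, hqm, lq, hlq⟩ := hq
    refine ⟨⟨Bp + Bq, fun u => (abs_add_le _ _).trans (add_le_add (hBp u) (hBq u))⟩, hpm.add hqm, ⟨lp + lq, ?_⟩⟩
    have he : (fun K => ∫ u, (p + q) u ∂μ K) = fun K => ∫ u, p u ∂μ K + ∫ u, q u ∂μ K := funext fun K =>
      integral_add (T4VarianceMatching.integrable_of_abs_le (μ K) hpm hBp)
        (T4VarianceMatching.integrable_of_abs_le (μ K) hqm hBq)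
    rw [he]
    exact hlp.add hlq
  | smul a p _ hp =>
    obtain ⟨⟨Bp, hBp⟩, hpm, lp, hlp⟩ := hp
    refine ⟨⟨|a| * Bp, fun u => ?_⟩, hpm.const_mul a, ⟨a * lp, ?_⟩⟩
    · rw [Pi.smul_apply, smul_eq_mul, abs_mul]
      exact mul_le_mul_of_nonneg_left (hBp u) (abs_nonneg a)
    · have he : (fun K => ∫ u, (a • p) u ∂μ K) = fun K => a * ∫ u, p u ∂μ K := funext fun K => by
        simp only [Pi.smul_apply, smul_eq_mul]
        exact integral_const_mul a _
      rw [he]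
      exact hlp.const_mul a

/-- The small-loop average `expMeanLogSUc` is measurable in every arity (tree `ExpMeanLog.measurable_expMeanLogSUc_E`). [cite: Balaban1987RG1, (0.4) p.253] -/
theorem measurableE_expMeanLogSUc {N : Type} [Fintype N] [DecidableEq N] [Nonempty N] :
    (ExpMeanLog.expMeanLogSUc (n := N)).MeasurableE :=
  fun m => ExpMeanLog.measurable_expMeanLogSUc_E m

/-- `ℰc` := Bałaban's exp-mean-log small-loop average on `SU(2)` in its CONTINUOUS total extension (tree
`ExpMeanLog.expMeanLogSUc`, = the printed operation of [Balaban1987RG1] (0.4) on the half-guard). [cite: Balaban1987RG1, (0.4) p.253] -/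
abbrev ℰc : LoopAverage (Matrix.specialUnitaryGroup (Fin 2) ℂ) := ExpMeanLog.expMeanLogSUc (n := Fin 2)

open Literature.MathematicalPhysics.QuantumLattice in
/-- **EXISTENCE OF THE CONTINUUM LIMIT PROPAGATES FROM LOOP STRINGS TO EVERY CONTINUOUS GAUGE-INVARIANT UNIT-LATTICE OBSERVABLE**
(`SU(2)`, `ℰ = expMeanLogSUc`): if all joint expectations of unit-scale averaged loop variables converge as `ε → 0`
(`HasContinuumLimit`), then `∫ f d(unitLaw K)` converges for EVERY continuous, gauge-invariant, measurable `f` on the unit-torus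
configurations — the would-be continuum law on the unit-lattice gauge orbit space `G^E/G^V` has all its moments.  Lévy's density of
the Wilson-loop algebra in `C(G^E/G^V)` on the finite connected unit graph ([Levy2004] Thm 3.1, tree `LevyDensity.dense_su2_of_connected`)
+ ε/3. [cite: Levy2004, Thm 3.1] -/
theorem exists_tendsto_integral_unitLaw (F : T3Family) {γ : ℝ} (hγ : 0 ≤ γ) (h : HasContinuumLimit (F.scheme ℰc γ))
    {f : GaugeField (F.P 0) 0 (Matrix.specialUnitaryGroup (Fin 2) ℂ) → ℝ} (hfc : Continuous f)
    (hfi : ∀ (u : GaugeTransf (F.P 0) 0 (Matrix.specialUnitaryGroup (Fin 2) ℂ)) (U : GaugeField (F.P 0) 0 _),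
      f (GaugeField.gaugeAct u U) = f U)
    (hfm : Measurable f) {B : ℝ} (hfb : ∀ u, |f u| ≤ B) :
    ∃ l, Tendsto (fun K => ∫ u, f u ∂F.unitLaw ℰc measurableE_expMeanLogSUc γ K) atTop (𝓝 l) := by
  -- the unit laws
  let μ : ℕ → Measure (GaugeField (F.P 0) 0 (Matrix.specialUnitaryGroup (Fin 2) ℂ)) :=
    fun K => F.unitLaw ℰc measurableE_expMeanLogSUc γ K
  haveI : ∀ K, IsProbabilityMeasure (μ K) := fun K => isProbabilityMeasure_unitLaw measurableE_expMeanLogSUc hγ K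
  -- the generators of the graph algebra have convergent integrals (they are constants times scheme strings)
  have hgen : ∀ q ∈ LevyDensity.loopTraceProducts (PBond.src (P := F.P 0) (j := 0)) PBond.tgt (fundamentalRep (Fin 2))
      (0 : F.USite), (∃ B, ∀ u, |q u| ≤ B) ∧ Measurable q ∧ ∃ l, Tendsto (fun K => ∫ u, q u ∂μ K) atTop (𝓝 l) := by
    rintro q ⟨l, rfl⟩
    obtain ⟨c, Cs, hq⟩ := loopTraceProduct_eq_string (F := F) l
    rw [hq]
    refine ⟨⟨|c|, fun u => ?_⟩, (measurable_list_prod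
      (fun (C : ULoop3 F) (u : GaugeField (F.P 0) 0 (Matrix.specialUnitaryGroup (Fin 2) ℂ)) => loopAt u (C.1.atLevel 0))
      (fun C => measurable_loopAt _) Cs).const_mul c, ?_⟩
    · rw [abs_mul]
      exact mul_le_of_le_one_right (abs_nonneg c) (abs_list_prod_le_one
        (fun (C : ULoop3 F) (u : GaugeField (F.P 0) 0 (Matrix.specialUnitaryGroup (Fin 2) ℂ)) => loopAt u (C.1.atLevel 0))
        (fun _ _ => abs_loopAt_le_one _ _) u Cs)
    · obtain ⟨l₀, hl₀⟩ := h Cs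
      refine ⟨c * l₀, ?_⟩
      have he : (fun K => ∫ u, c * (Cs.map fun C => loopAt u (C.1.atLevel 0)).prod ∂μ K) =
          fun K => c * (F.scheme ℰc γ).expectAt K Cs := funext fun K => by
        rw [integral_const_mul, expectAt_eq_integral_unitLaw measurableE_expMeanLogSUc hγ K Cs]
      rw [he]
      exact hl₀.const_mul c
  -- Lévy + ε/3
  refine exists_tendsto_of_forall_approx fun ε hε => ?_
  obtain ⟨p, hp, hfp⟩ := LevyDensity.dense_su2_of_connected (PBond.src (P := F.P 0) (j := 0)) PBond.tgt
    (v₀ := (0 : F.USite)) exists_isPath_zero (F := f) hfc hfi hε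
  obtain ⟨⟨B', hB'⟩, hpm, l, hl⟩ := tendsto_integral_of_mem_span μ hgen hp
  refine ⟨fun K => ∫ u, p u ∂μ K, ⟨l, hl⟩, fun K => ?_⟩
  rw [← integral_sub (T4VarianceMatching.integrable_of_abs_le (μ K) hfm hfb)
    (T4VarianceMatching.integrable_of_abs_le (μ K) hpm hB')]
  have hb := norm_integral_le_of_norm_le_const (μ := μ K) (f := fun u => f u - p u) (C := ε)
    (Eventually.of_forall fun u => by simpa [Real.norm_eq_abs] using hfp u)
  simpa [Real.norm_eq_abs] using hb

/-- **THRESHOLD REMOVAL — THE TRANSFER OF EXISTENCE (`SU(2)`, `ℰ = expMeanLogSUc`)**: if the REFINED family `F.refine n` (unit of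
length divided by `L^{n}`, dimensionless coupling `γL^{-n}`; the same lattices and Wilson weights, [Balaban1985UV3] (1)–(3) p. 256) has the
full-sequence continuum limit of all joint expectations of its unit-scale averaged loop variables, then so has `F` at coupling `γ`
(Jaffe–Witten §6.5: existence of the `ε → 0` limits of the expectations).  Proof: §3 refinement identity + `exists_tendsto_integral_unitLaw`
for the refined family applied to the continuous gauge-invariant `coarseObs`. [cite: JaffeWittenClay2006, §6.5 p.11] -/
theorem hasContinuumLimit_of_refine (F : T3Family) (n : ℕ) {γ : ℝ} (hγ : 0 ≤ γ)
    (h : HasContinuumLimit ((F.refine n).scheme ℰc (γ * ((F.L : ℝ)⁻¹) ^ n))) : HasContinuumLimit (F.scheme ℰc γ) := by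
  intro Cs
  have hγ' : 0 ≤ γ * ((F.L : ℝ)⁻¹) ^ n := mul_nonneg hγ (pow_nonneg (inv_nonneg.mpr (Nat.cast_nonneg _)) _)
  obtain ⟨l, hl⟩ := exists_tendsto_integral_unitLaw (F.refine n) hγ' h (continuous_coarseObs F n Cs)
    (coarseObs_gaugeAct F n ℰc Cs) (measurable_coarseObs F n ℰc measurableE_expMeanLogSUc Cs)
    (abs_coarseObs_le_one F n ℰc Cs)
  refine ⟨l, (tendsto_add_atTop_iff_nat n).mp ?_⟩
  have hkey : (fun K => (F.scheme ℰc γ).expectAt (K + n) Cs) =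
      fun K => ∫ u, coarseObs F n ℰc Cs u ∂(F.refine n).unitLaw ℰc measurableE_expMeanLogSUc (γ * ((F.L : ℝ)⁻¹) ^ n) K :=
    funext fun K => expectAt_refine F n ℰc measurableE_expMeanLogSUc hγ K Cs
  rw [hkey]
  exact hl

/-- **THRESHOLD REMOVAL FOR THE TARGET**: `ContinuumYM3Torus` for the refined pair `(F.refine n, γL^{-n})` implies it for `(F, γ)`
(existence transferred by `hasContinuumLimit_of_refine`; uniqueness, RP and covariance are outright on `SU(N)`, node
`continuumYM3Torus_iff_hasContinuumLimit_SU`). [cite: JaffeWittenClay2006, §6.5 p.11] -/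
theorem continuumYM3Torus_of_refine (F : T3Family) (n : ℕ) {γ : ℝ} (hγ : 0 ≤ γ)
    (h : ContinuumYM3Torus (F.refine n) ℰc (γ * ((F.L : ℝ)⁻¹) ^ n)) : ContinuumYM3Torus F ℰc γ :=
  (continuumYM3Torus_iff_hasContinuumLimit_SU F ℰc measurableE_expMeanLogSUc hγ).mpr
    (hasContinuumLimit_of_refine F n hγ h.1)

/-- **A THRESHOLD UNIFORM ALONG THE REFINEMENTS OF ONE FAMILY IS NO THRESHOLD** (`SU(2)`, `ℰ = expMeanLogSUc`): if ONE `γ₁ > 0`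
serves every refinement `F.refine n` of the family (every finer unit, same block size and physical torus) — the shape in which the
d = 3 stability constants are printed, [Balaban1985UV3] (3) p. 256 «O(1) depending on g and ε₀ only» — then `ContinuumYM3Torus F ℰ γ`
holds for EVERY `γ > 0`: refine until `γL^{-n} ≤ γ₁` (superrenormalisable scaling: `g_k² = g²L^kε` decreases toward the ultraviolet). [cite: Balaban1985UV3, (1)-(3) p.256] -/
theorem continuumYM3Torus_of_refine_threshold (F : T3Family) {γ₁ : ℝ} (hγ₁ : 0 < γ₁)
    (hY : ∀ (n : ℕ) (γ' : ℝ), 0 < γ' → γ' ≤ γ₁ → ContinuumYM3Torus (F.refine n) ℰc γ')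
    {γ : ℝ} (hγ : 0 < γ) : ContinuumYM3Torus F ℰc γ := by
  have hL : (1 : ℝ) < F.L := by exact_mod_cast F.hL.2
  have hq0 : 0 ≤ ((F.L : ℝ))⁻¹ := inv_nonneg.mpr (zero_le_one.trans hL.le)
  have hq1 : ((F.L : ℝ))⁻¹ < 1 := inv_lt_one_of_one_lt₀ hL
  obtain ⟨n, hn⟩ := ((tendsto_pow_atTop_nhds_zero_of_lt_one hq0 hq1).eventually
    (ge_mem_nhds (show (0 : ℝ) < γ₁ / γ from div_pos hγ₁ hγ))).exists
  refine continuumYM3Torus_of_refine F n hγ.le (hY n _ ?_ ?_)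
  · exact mul_pos hγ (pow_pos (inv_pos.mpr (zero_lt_one.trans hL)) n)
  · calc γ * ((F.L : ℝ))⁻¹ ^ n ≤ γ * (γ₁ / γ) := mul_le_mul_of_nonneg_left hn hγ.le
      _ = γ₁ := mul_div_cancel₀ γ₁ hγ.ne'

/-- **Y1 WITH A VOLUME-UNIFORM THRESHOLD IS THRESHOLD-FREE** (`SU(2)`, `ℰ = expMeanLogSUc`): if ONE `γ₁ > 0` serves EVERY three-torus
family (every block size `L`, every volume exponent `m`), then `ContinuumYM3Torus F ℰ γ` holds for EVERY family and EVERY `γ > 0` — the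
cell's «`Y1_SU2 → ThresholdFree_SU2`» at the continuous printed averaging. [cite: Balaban1985UV3, (1)-(3) p.256] -/
theorem continuumYM3Torus_of_uniform_threshold {γ₁ : ℝ} (hγ₁ : 0 < γ₁)
    (hY : ∀ (F : T3Family) (γ : ℝ), 0 < γ → γ ≤ γ₁ → ContinuumYM3Torus F ℰc γ)
    (F : T3Family) {γ : ℝ} (hγ : 0 < γ) : ContinuumYM3Torus F ℰc γ :=
  continuumYM3Torus_of_refine_threshold F hγ₁ (fun n γ' h0 h1 => hY (F.refine n) γ' h0 h1) hγ

end Apex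

end Literature.MathematicalPhysics.QuantumFieldTheory.Balaban1983to89.T3ThresholdRemoval

end
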